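import Summits.FinalStateConjecture.FinalStateConjecture.Theorems.EIHFluxBalanceInertialRecessionChargeKinematicsPassage

/-!
# Route EIHFluxBalance — `InertialRecession`, line `old-light-leaves-the-cone`: charge kinematics,
# XIII (escape budgets)

Helper file for the crux `stmt-FinalStateConjecture-10166`
(`Summit.FinalStateConjecture.FinalStateConjecture.Theses.EIHFluxBalance.InertialRecession`), second line
lead, endgame stub `stub_expandingChargeKinematics` (S4: abstract quasi-conserved window charges with the
slack-form window law and the single-hole identification ⇒ Cesàro velocities of the painted centres).
THE ESCAPE SERIES: the endgame for `N = 3` (Case A all-pairs freezing is `ChargeKinematicsAllPairs*`;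
Case B, the escape of a fast hole from a velocity-tight pair, is this series; the assembly is
`ChargeKinematicsThree`).

XIII — ESCAPE BUDGETS: the velocity increment of a member of a velocity-tight pair from the pair
bookkeeping (`pair_velocity_increment_le`), budget domination by two radii (`integral_budget_le_two`),
the two-partner budget (`two_partner_budget_le`), the budget of a passage (`passage_interval_budget_le`),
the antitone tail (`budget_tail_antitone`) and the arithmetic of the passage term
(`passage_duration_term_le`).

Every statement is Mathlib-only real analysis over the stub's verbatim hypotheses ([folklore]); the abstract
charge `P` is arbitrary (adversarial), constrained only by the window law and the identification.
-/

set_option linter.dupNamespace false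

noncomputable section

open Filter Set Metric Real
open scoped Topology

namespace Summit.FinalStateConjecture.FinalStateConjecture.Theorems.ChargeKinematics

open Literature.Geometry.Lorentzian

/-! ## Escape budgets -/

section EscapeBudgets

open MeasureTheory intervalIntegral

/-- **Velocity increment of a member of a velocity-tight pair from the pair bookkeeping.** If at two
times the four components `W` of a window charge are `e`-close to the kinematic pair charge
`(M_aγ_a + M_cγ_c, M_aγ_a v_a + M_cγ_c v_c)`, each component moved by at most `L`, and the relative
velocity `v_c − v_a` has size `≤ β'` at both times, then (with `γ ≥ 1`, `‖v‖ ≤ 1`)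
`‖Δv_a‖ ≤ 4(L + e₁ + e₂)/(M_a + M_c) + 2β'`: write `p = E v_a + M_cγ_c (v_c − v_a)`. [folklore] -/
theorem pair_velocity_increment_le {Ma Mc : ℝ} {va₁ vc₁ va₂ vc₂ : E3} {γa₁ γc₁ γa₂ γc₂ : ℝ}
    {W₁ W₂ : Fin 4 → ℝ} {L e₁ e₂ β' : ℝ} (hMa : 0 < Ma) (hMc : 0 < Mc)
    (hγa₁ : 1 ≤ γa₁) (hγc₁ : 1 ≤ γc₁) (hγa₂ : 1 ≤ γa₂) (hγc₂ : 1 ≤ γc₂)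
    (hva₁ : ‖va₁‖ ≤ 1) (hvc₁ : ‖vc₁‖ ≤ 1)
    (hr₁ : ‖vc₁ - va₁‖ ≤ β') (hr₂ : ‖vc₂ - va₂‖ ≤ β')
    (hid₁ : |W₁ 0 - (Ma * γa₁ + Mc * γc₁)| ≤ e₁ ∧
      ∀ k : Fin 3, |W₁ k.succ - (Ma * γa₁ * va₁ k + Mc * γc₁ * vc₁ k)| ≤ e₁)
    (hid₂ : |W₂ 0 - (Ma * γa₂ + Mc * γc₂)| ≤ e₂ ∧
      ∀ k : Fin 3, |W₂ k.succ - (Ma * γa₂ * va₂ k + Mc * γc₂ * vc₂ k)| ≤ e₂)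
    (hlaw : ∀ μ : Fin 4, |W₂ μ - W₁ μ| ≤ L) :
    ‖va₂ - va₁‖ ≤ 4 * (L + e₁ + e₂) / (Ma + Mc) + 2 * β' := by
  -- energies and momenta of the pair
  set E₁ : ℝ := Ma * γa₁ + Mc * γc₁ with hE₁
  set E₂ : ℝ := Ma * γa₂ + Mc * γc₂ with hE₂
  set p₁ : E3 := (Ma * γa₁) • va₁ + (Mc * γc₁) • vc₁ with hp₁
  set p₂ : E3 := (Ma * γa₂) • va₂ + (Mc * γc₂) • vc₂ with hp₂
  have hMM : 0 < Ma + Mc := add_pos hMa hMc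
  have hE₁ge : Ma + Mc ≤ E₁ := by simp only [hE₁]; nlinarith
  have hE₂ge : Ma + Mc ≤ E₂ := by simp only [hE₂]; nlinarith
  have hE₁pos : 0 < E₁ := hMM.trans_le hE₁ge
  have hE₂pos : 0 < E₂ := hMM.trans_le hE₂ge
  set I : ℝ := L + e₁ + e₂ with hI
  -- component bookkeeping: `|E₂ - E₁| ≤ I`, `|p₂ k - p₁ k| ≤ I`
  have hE : |E₂ - E₁| ≤ I := by
    have h1 := hid₁.1; have h2 := hid₂.1; have h3 := hlaw 0
    rw [abs_le] at h1 h2 h3 ⊢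
    constructor <;> linarith
  have hpk : ∀ k : Fin 3, |p₂ k - p₁ k| ≤ I := by
    intro k
    have h1 := hid₁.2 k; have h2 := hid₂.2 k; have h3 := hlaw k.succ
    have e1 : p₁ k = Ma * γa₁ * va₁ k + Mc * γc₁ * vc₁ k := by
      simp only [hp₁, PiLp.add_apply, PiLp.smul_apply, smul_eq_mul]
    have e2 : p₂ k = Ma * γa₂ * va₂ k + Mc * γc₂ * vc₂ k := by
      simp only [hp₂, PiLp.add_apply, PiLp.smul_apply, smul_eq_mul]
    rw [e1, e2]
    rw [abs_le] at h1 h2 h3 ⊢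
    constructor <;> linarith
  have hp : ‖p₂ - p₁‖ ≤ 3 * I := by
    refine (norm_le_sum_abs_coord _).trans ?_
    calc ∑ k, |(p₂ - p₁) k| ≤ ∑ _k : Fin 3, I := Finset.sum_le_sum fun k _ ↦ by
            rw [PiLp.sub_apply]; exact hpk k
      _ = 3 * I := by simp [Finset.sum_const, nsmul_eq_mul]
  -- `‖p₁‖ ≤ E₁`
  have hp₁le : ‖p₁‖ ≤ E₁ := by
    calc ‖p₁‖ ≤ ‖(Ma * γa₁) • va₁‖ + ‖(Mc * γc₁) • vc₁‖ := norm_add_le _ _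
      _ ≤ Ma * γa₁ * 1 + Mc * γc₁ * 1 := by
          rw [norm_smul, norm_smul, Real.norm_eq_abs, Real.norm_eq_abs,
            abs_of_pos (by positivity : 0 < Ma * γa₁), abs_of_pos (by positivity : 0 < Mc * γc₁)]
          gcongr
      _ = E₁ := by simp only [hE₁]; ring
  -- the decomposition `v_a = E⁻¹ (p - M_c γ_c (v_c - v_a))`
  have hva₁eq : va₁ = E₁⁻¹ • (p₁ - (Mc * γc₁) • (vc₁ - va₁)) := by
    have : p₁ - (Mc * γc₁) • (vc₁ - va₁) = E₁ • va₁ := by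
      simp only [hp₁, hE₁, smul_sub, add_smul]; abel
    rw [this, smul_smul, inv_mul_cancel₀ hE₁pos.ne', one_smul]
  have hva₂eq : va₂ = E₂⁻¹ • (p₂ - (Mc * γc₂) • (vc₂ - va₂)) := by
    have : p₂ - (Mc * γc₂) • (vc₂ - va₂) = E₂ • va₂ := by
      simp only [hp₂, hE₂, smul_sub, add_smul]; abel
    rw [this, smul_smul, inv_mul_cancel₀ hE₂pos.ne', one_smul]
  -- the momentum part: `‖p₂/E₂ - p₁/E₁‖ ≤ 4I/(M_a+M_c)`
  have hmom : ‖E₂⁻¹ • p₂ - E₁⁻¹ • p₁‖ ≤ 4 * I / (Ma + Mc) := by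
    have hsplit : E₂⁻¹ • p₂ - E₁⁻¹ • p₁ = E₂⁻¹ • (p₂ - p₁) + (E₂⁻¹ - E₁⁻¹) • p₁ := by
      rw [smul_sub, sub_smul]; abel
    rw [hsplit]
    refine (norm_add_le _ _).trans ?_
    rw [norm_smul, norm_smul, Real.norm_eq_abs, Real.norm_eq_abs, abs_of_pos (inv_pos.mpr hE₂pos)]
    have h1 : E₂⁻¹ * ‖p₂ - p₁‖ ≤ E₂⁻¹ * (3 * I) := mul_le_mul_of_nonneg_left hp (inv_pos.mpr hE₂pos).le
    have h2 : |E₂⁻¹ - E₁⁻¹| * ‖p₁‖ ≤ E₂⁻¹ * I := by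
      have hinv : E₂⁻¹ - E₁⁻¹ = (E₁ - E₂) / (E₁ * E₂) := by
        field_simp
      rw [hinv, abs_div, abs_of_pos (mul_pos hE₁pos hE₂pos)]
      have hIE : |E₁ - E₂| ≤ I := by rw [abs_sub_comm]; exact hE
      have hI0 : 0 ≤ I := (abs_nonneg _).trans hE
      calc |E₁ - E₂| / (E₁ * E₂) * ‖p₁‖ ≤ I / (E₁ * E₂) * E₁ :=
            mul_le_mul (div_le_div_of_nonneg_right hIE (by positivity)) hp₁le (norm_nonneg _)
              (by positivity)
        _ = E₂⁻¹ * I := by field_simp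
    have h3 : E₂⁻¹ * (3 * I) + E₂⁻¹ * I = 4 * I / E₂ := by ring
    have hI0 : 0 ≤ I := (abs_nonneg _).trans hE
    have h4 : 4 * I / E₂ ≤ 4 * I / (Ma + Mc) :=
      div_le_div_of_nonneg_left (by positivity) hMM hE₂ge
    linarith
  -- the internal part: `‖M_c γ_c (v_c - v_a)/E‖ ≤ β'` at each time
  have hint : ∀ {E Mγ : ℝ} {w : E3}, 0 < E → 0 ≤ Mγ → Mγ ≤ E → ‖w‖ ≤ β' →
      ‖E⁻¹ • (Mγ • w)‖ ≤ β' := by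
    intro E Mγ w hE hMγ hle hw
    rw [smul_smul, norm_smul, Real.norm_eq_abs, abs_of_nonneg (by positivity)]
    have : E⁻¹ * Mγ ≤ 1 := by
      rw [inv_mul_le_iff₀ hE]; simpa using hle
    calc E⁻¹ * Mγ * ‖w‖ ≤ 1 * ‖w‖ := mul_le_mul_of_nonneg_right this (norm_nonneg _)
      _ ≤ β' := by rw [one_mul]; exact hw
  have hc₁ : Mc * γc₁ ≤ E₁ := by simp only [hE₁]; nlinarith
  have hc₂ : Mc * γc₂ ≤ E₂ := by simp only [hE₂]; nlinarith
  have hi₁ := hint hE₁pos (by positivity) hc₁ hr₁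
  have hi₂ := hint hE₂pos (by positivity) hc₂ hr₂
  -- assemble
  have hdecomp : va₂ - va₁ = (E₂⁻¹ • p₂ - E₁⁻¹ • p₁) -
      (E₂⁻¹ • ((Mc * γc₂) • (vc₂ - va₂)) - E₁⁻¹ • ((Mc * γc₁) • (vc₁ - va₁))) := by
    conv_lhs => rw [hva₂eq, hva₁eq]
    simp only [smul_sub]; abel
  rw [hdecomp]
  calc ‖(E₂⁻¹ • p₂ - E₁⁻¹ • p₁) -
        (E₂⁻¹ • ((Mc * γc₂) • (vc₂ - va₂)) - E₁⁻¹ • ((Mc * γc₁) • (vc₁ - va₁)))‖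
      ≤ ‖E₂⁻¹ • p₂ - E₁⁻¹ • p₁‖ +
        ‖E₂⁻¹ • ((Mc * γc₂) • (vc₂ - va₂)) - E₁⁻¹ • ((Mc * γc₁) • (vc₁ - va₁))‖ := norm_sub_le _ _
    _ ≤ 4 * I / (Ma + Mc) + (β' + β') := by
        refine add_le_add hmom ((norm_sub_le _ _).trans (add_le_add hi₂ hi₁))
    _ = 4 * (L + e₁ + e₂) / (Ma + Mc) + 2 * β' := by simp only [hI]; ring

/-- Budget domination by two radii: if on `[a, b]` the radius `R ≥ 1` dominates, at every point, one of
two continuous radii `R₁, R₂ ≥ 1`, then `∫(R⁻² + R^{-7/4}) ≤ ∫(R₁⁻² + R₁^{-7/4}) + ∫(R₂⁻² + R₂^{-7/4})`.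
[folklore] -/
theorem integral_budget_le_two {R R₁ R₂ : ℝ → ℝ} {a b : ℝ} (hab : a ≤ b)
    (hR : ContinuousOn R (Set.Icc a b)) (hR₁ : Continuous R₁) (hR₂ : Continuous R₂)
    (hR1 : ∀ s ∈ Set.Icc a b, 1 ≤ R s) (hR₁1 : ∀ s, 1 ≤ R₁ s) (hR₂1 : ∀ s, 1 ≤ R₂ s)
    (hex : ∀ s ∈ Set.Icc a b, R₁ s ≤ R s ∨ R₂ s ≤ R s) :
    ∫ s in a..b, (((R s) ^ 2)⁻¹ + ((R s) ^ (7 / 4 : ℝ))⁻¹) ≤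
      (∫ s in a..b, (((R₁ s) ^ 2)⁻¹ + ((R₁ s) ^ (7 / 4 : ℝ))⁻¹)) +
        ∫ s in a..b, (((R₂ s) ^ 2)⁻¹ + ((R₂ s) ^ (7 / 4 : ℝ))⁻¹) := by
  have h := integral_budget_le_sum (Finset.univ : Finset Bool) (R := R)
    (Rp := fun q s ↦ Bool.rec (R₂ s) (R₁ s) q) hab hR
    (fun q _ ↦ by cases q <;> assumption) hR1 (fun q _ s ↦ by cases q <;> simp [hR₁1 s, hR₂1 s])
    (fun s hs ↦ by
      rcases hex s hs with h | h
      · exact ⟨true, Finset.mem_univ _, h⟩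
      · exact ⟨false, Finset.mem_univ _, h⟩)
  simpa [Fintype.sum_bool, add_comm] using h

/-- **Two-partner budget.** If on `[t₀, τ]` the radius `R ≥ 1` dominates `min(min(d₁, d₂)/3, c₂ s)`
where both distances are fly-by controlled — `dᵢ ≥ max(m₀, |φᵢ|)` with `φᵢ` moving monotonically at
rate `≥ gᵢ > 0` — then `∫(R⁻² + R^{-7/4})` is bounded by the two passage budgets. [folklore] -/
theorem two_partner_budget_le {R d₁ d₂ φ₁ φ₁' φ₂ φ₂' : ℝ → ℝ} {t₀ τ m₀ c₂ g₁ g₂ : ℝ} (ht₀ : 0 < t₀)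
    (hτ : t₀ ≤ τ) (hm₀ : 0 < m₀) (hc₂ : 0 < c₂) (hg₁ : 0 < g₁) (hg₂ : 0 < g₂)
    (hRcont : ContinuousOn R (Set.Icc t₀ τ)) (hd₁ : Continuous d₁) (hd₂ : Continuous d₂)
    (hR1 : ∀ s ∈ Set.Icc t₀ τ, 1 ≤ R s)
    (hRge : ∀ s ∈ Set.Icc t₀ τ, min (min (d₁ s) (d₂ s) / 3) (c₂ * s) ≤ R s)
    (hfl₁ : ∀ s ∈ Set.Icc t₀ τ, max m₀ |φ₁ s| ≤ d₁ s)
    (hfl₂ : ∀ s ∈ Set.Icc t₀ τ, max m₀ |φ₂ s| ≤ d₂ s)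
    (hφ₁ : ∀ s, HasDerivAt φ₁ (φ₁' s) s) (hφ₁' : Continuous φ₁')
    (hmono₁ : ∀ s ∈ Set.Icc t₀ τ, g₁ ≤ φ₁' s)
    (hφ₂ : ∀ s, HasDerivAt φ₂ (φ₂' s) s) (hφ₂' : Continuous φ₂')
    (hmono₂ : ∀ s ∈ Set.Icc t₀ τ, g₂ ≤ φ₂' s) :
    ∫ s in t₀..τ, (((R s) ^ 2)⁻¹ + ((R s) ^ (7 / 4 : ℝ))⁻¹) ≤
      (9 * (2 * 2 * m₀ ^ (1 - 2 : ℝ) / ((2 - 1) * g₁)) +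
        (3 : ℝ) ^ (7 / 4 : ℝ) * (2 * (7 / 4) * m₀ ^ (1 - 7 / 4 : ℝ) / ((7 / 4 - 1) * g₁)) +
        ((c₂ ^ 2 * t₀)⁻¹ + 4 / 3 * c₂ ^ (-(7 / 4) : ℝ) * t₀ ^ (-(3 / 4) : ℝ))) +
      (9 * (2 * 2 * m₀ ^ (1 - 2 : ℝ) / ((2 - 1) * g₂)) +
        (3 : ℝ) ^ (7 / 4 : ℝ) * (2 * (7 / 4) * m₀ ^ (1 - 7 / 4 : ℝ) / ((7 / 4 - 1) * g₂)) +
        ((c₂ ^ 2 * t₀)⁻¹ + 4 / 3 * c₂ ^ (-(7 / 4) : ℝ) * t₀ ^ (-(3 / 4) : ℝ))) := by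
  -- the two clipped one-partner radii
  set R₁ : ℝ → ℝ := fun s ↦ max 1 (min (d₁ s / 3) (c₂ * s)) with hR₁def
  set R₂ : ℝ → ℝ := fun s ↦ max 1 (min (d₂ s / 3) (c₂ * s)) with hR₂def
  have hc₁ : Continuous R₁ :=
    continuous_const.max ((hd₁.div_const 3).min (continuous_const.mul continuous_id))
  have hc₂' : Continuous R₂ :=
    continuous_const.max ((hd₂.div_const 3).min (continuous_const.mul continuous_id))
  have hex : ∀ s ∈ Set.Icc t₀ τ, R₁ s ≤ R s ∨ R₂ s ≤ R s := by
    intro s hs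
    have h1 := hR1 s hs
    have hge := hRge s hs
    rcases le_total (d₁ s) (d₂ s) with h | h
    · left
      rw [min_eq_left h] at hge
      exact max_le h1 hge
    · right
      rw [min_eq_right h] at hge
      exact max_le h1 hge
  have hdom := integral_budget_le_two hτ hRcont hc₁ hc₂' hR1 (fun s ↦ le_max_left _ _)
    (fun s ↦ le_max_left _ _) hex
  refine hdom.trans (add_le_add ?_ ?_)
  · refine passage_budget_le ht₀ hτ hm₀ hc₂ hg₁ hc₁.continuousOn (fun s _ ↦ le_max_left _ _)
      (fun s hs ↦ ?_) hφ₁ hφ₁' hmono₁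
    have := hfl₁ s hs
    exact le_trans (min_le_min (by linarith) le_rfl) (le_max_right _ _)
  · refine passage_budget_le ht₀ hτ hm₀ hc₂ hg₂ hc₂'.continuousOn (fun s _ ↦ le_max_left _ _)
      (fun s hs ↦ ?_) hφ₂ hφ₂' hmono₂
    have := hfl₂ s hs
    exact le_trans (min_le_min (by linarith) le_rfl) (le_max_right _ _)

/-- **Budget of a passage.** On an interval `[σ₂, σ₃]` of length `≤ Λ` where the radius `R ≥ 1`
dominates `min(min(d₁, d)/3, c₂ s)` with `d₁` fly-by controlled (`d₁ ≥ max(m₀, |φ|)`, `φ' ≥ g`) and the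
partner distance `d ≥ D₂/2 > 0`, the budget is a passage budget plus `Λ·((D₂/6)⁻² + (D₂/6)^{-7/4})`.
[folklore] -/
theorem passage_interval_budget_le {R d₁ d φ φ' : ℝ → ℝ} {σ₂ σ₃ m₀ c₂ g D₂ Λ : ℝ} (hσ₂ : 0 < σ₂)
    (h23 : σ₂ ≤ σ₃) (hm₀ : 0 < m₀) (hc₂ : 0 < c₂) (hg : 0 < g) (hD₂ : 0 < D₂)
    (hRcont : ContinuousOn R (Set.Icc σ₂ σ₃)) (hd₁ : Continuous d₁) (hd : Continuous d)
    (hR1 : ∀ s ∈ Set.Icc σ₂ σ₃, 1 ≤ R s)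
    (hRge : ∀ s ∈ Set.Icc σ₂ σ₃, min (min (d₁ s) (d s) / 3) (c₂ * s) ≤ R s)
    (hfl : ∀ s ∈ Set.Icc σ₂ σ₃, max m₀ |φ s| ≤ d₁ s)
    (hφ : ∀ s, HasDerivAt φ (φ' s) s) (hφ' : Continuous φ') (hmono : ∀ s ∈ Set.Icc σ₂ σ₃, g ≤ φ' s)
    (hdlow : ∀ s ∈ Set.Icc σ₂ σ₃, D₂ / 2 ≤ d s) (hdur : σ₃ - σ₂ ≤ Λ) :
    ∫ s in σ₂..σ₃, (((R s) ^ 2)⁻¹ + ((R s) ^ (7 / 4 : ℝ))⁻¹) ≤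
      (9 * (2 * 2 * m₀ ^ (1 - 2 : ℝ) / ((2 - 1) * g)) +
        (3 : ℝ) ^ (7 / 4 : ℝ) * (2 * (7 / 4) * m₀ ^ (1 - 7 / 4 : ℝ) / ((7 / 4 - 1) * g)) +
        ((c₂ ^ 2 * σ₂)⁻¹ + 4 / 3 * c₂ ^ (-(7 / 4) : ℝ) * σ₂ ^ (-(3 / 4) : ℝ))) +
      Λ * (((D₂ / 6) ^ 2)⁻¹ + ((D₂ / 6) ^ (7 / 4 : ℝ))⁻¹) := by
  -- clipped radii: the fly-by one and the partner one (clipped at `D₂/6`)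
  set R₁ : ℝ → ℝ := fun s ↦ max 1 (min (d₁ s / 3) (c₂ * s)) with hR₁def
  set R₂ : ℝ → ℝ := fun s ↦ max 1 (max (D₂ / 6) (d s / 3)) with hR₂def
  have hc₁ : Continuous R₁ :=
    continuous_const.max ((hd₁.div_const 3).min (continuous_const.mul continuous_id))
  have hc₂' : Continuous R₂ := continuous_const.max (continuous_const.max (hd.div_const 3))
  have hex : ∀ s ∈ Set.Icc σ₂ σ₃, R₁ s ≤ R s ∨ R₂ s ≤ R s := by
    intro s hs
    have h1 := hR1 s hs
    have hge := hRge s hs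
    rw [← min_div_div_right (by norm_num : (0 : ℝ) ≤ 3), min_right_comm] at hge
    rcases min_le_iff.mp hge with h | h
    · left; exact max_le h1 h
    · right
      refine max_le h1 (max_le ?_ h)
      have := hdlow s hs
      linarith
  have hdom := integral_budget_le_two h23 hRcont hc₁ hc₂' hR1 (fun s ↦ le_max_left _ _)
    (fun s ↦ le_max_left _ _) hex
  refine hdom.trans (add_le_add ?_ ?_)
  · refine passage_budget_le hσ₂ h23 hm₀ hc₂ hg hc₁.continuousOn (fun s _ ↦ le_max_left _ _)
      (fun s hs ↦ ?_) hφ hφ' hmono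
    have := hfl s hs
    exact le_trans (min_le_min (by linarith) le_rfl) (le_max_right _ _)
  · have hD6 : 0 < D₂ / 6 := by positivity
    have hpt : ∀ s ∈ Set.Icc σ₂ σ₃, ((R₂ s) ^ 2)⁻¹ + ((R₂ s) ^ (7 / 4 : ℝ))⁻¹ ≤
        ((D₂ / 6) ^ 2)⁻¹ + ((D₂ / 6) ^ (7 / 4 : ℝ))⁻¹ := by
      intro s _
      have hge : D₂ / 6 ≤ R₂ s := (le_max_left _ _).trans (le_max_right _ _)
      exact add_le_add (inv_anti₀ (pow_pos hD6 2) (pow_le_pow_left₀ hD6.le hge 2))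
        (inv_rpow_le_inv_rpow hD6 hge (by norm_num))
    have hI : IntervalIntegrable (fun s ↦ ((R₂ s) ^ 2)⁻¹ + ((R₂ s) ^ (7 / 4 : ℝ))⁻¹) volume σ₂ σ₃ := by
      have hpos : ∀ s, 0 < R₂ s := fun s ↦ one_pos.trans_le (le_max_left _ _)
      refine Continuous.intervalIntegrable (Continuous.add ?_ ?_) _ _
      · exact (hc₂'.pow 2).inv₀ fun s ↦ (pow_pos (hpos s) 2).ne'
      · exact (hc₂'.rpow_const fun s ↦ Or.inr (by norm_num)).inv₀ fun s ↦
          (Real.rpow_pos_of_pos (hpos s) _).ne'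
    calc ∫ s in σ₂..σ₃, (((R₂ s) ^ 2)⁻¹ + ((R₂ s) ^ (7 / 4 : ℝ))⁻¹)
        ≤ ∫ _s in σ₂..σ₃, (((D₂ / 6) ^ 2)⁻¹ + ((D₂ / 6) ^ (7 / 4 : ℝ))⁻¹) :=
          intervalIntegral.integral_mono_on h23 hI intervalIntegrable_const hpt
      _ = (σ₃ - σ₂) * (((D₂ / 6) ^ 2)⁻¹ + ((D₂ / 6) ^ (7 / 4 : ℝ))⁻¹) := by
          rw [intervalIntegral.integral_const, smul_eq_mul]
      _ ≤ Λ * (((D₂ / 6) ^ 2)⁻¹ + ((D₂ / 6) ^ (7 / 4 : ℝ))⁻¹) :=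
          mul_le_mul_of_nonneg_right hdur (by positivity)

/-- The tail of the window budget is antitone in the starting time. [folklore] -/
theorem budget_tail_antitone {c t₀ s₀ : ℝ} (hc : 0 < c) (ht₀ : 0 < t₀) (h : t₀ ≤ s₀) :
    (c ^ 2 * s₀)⁻¹ + 4 / 3 * c ^ (-(7 / 4) : ℝ) * s₀ ^ (-(3 / 4) : ℝ) ≤
      (c ^ 2 * t₀)⁻¹ + 4 / 3 * c ^ (-(7 / 4) : ℝ) * t₀ ^ (-(3 / 4) : ℝ) := by
  have h1 : (c ^ 2 * s₀)⁻¹ ≤ (c ^ 2 * t₀)⁻¹ := by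
    apply inv_anti₀ (by positivity)
    exact mul_le_mul_of_nonneg_left h (by positivity)
  have h2 : s₀ ^ (-(3 / 4) : ℝ) ≤ t₀ ^ (-(3 / 4) : ℝ) :=
    Real.rpow_le_rpow_of_nonpos ht₀ h (by norm_num)
  have h3 : 0 ≤ 4 / 3 * c ^ (-(7 / 4) : ℝ) := by positivity
  nlinarith [mul_le_mul_of_nonneg_left h2 h3]

/-- Arithmetic of the passage term: for `D₂ ≥ m₀ ≥ 1`,
`(16D₂/g)·((D₂/6)⁻² + (D₂/6)^{-7/4}) ≤ (1152/g)·m₀^{-3/4}`. [folklore] -/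
theorem passage_duration_term_le {D₂ m₀ g : ℝ} (hm₀ : 1 ≤ m₀) (hD : m₀ ≤ D₂) (hg : 0 < g) :
    16 * D₂ / g * (((D₂ / 6) ^ 2)⁻¹ + ((D₂ / 6) ^ (7 / 4 : ℝ))⁻¹) ≤
      1152 / g * m₀ ^ (-(3 / 4) : ℝ) := by
  have hD1 : 1 ≤ D₂ := hm₀.trans hD
  have hDpos : 0 < D₂ := one_pos.trans_le hD1
  have hm₀pos : 0 < m₀ := one_pos.trans_le hm₀
  -- the two pieces
  have h1 : 16 * D₂ / g * ((D₂ / 6) ^ 2)⁻¹ = 576 / g * D₂⁻¹ := by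
    field_simp
    ring
  have h2 : 16 * D₂ / g * ((D₂ / 6) ^ (7 / 4 : ℝ))⁻¹ = 16 * (6 : ℝ) ^ (7 / 4 : ℝ) / g * D₂ ^ (-(3 / 4) : ℝ) := by
    rw [Real.div_rpow hDpos.le (by norm_num), inv_div]
    have : D₂ ^ (-(3 / 4) : ℝ) = D₂ * (D₂ ^ (7 / 4 : ℝ))⁻¹ := by
      rw [← Real.rpow_neg hDpos.le, show (-(3 / 4) : ℝ) = 1 + -(7 / 4 : ℝ) by norm_num,
        Real.rpow_add hDpos, Real.rpow_one]
    rw [this]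
    field_simp
  have hinvD : D₂⁻¹ ≤ m₀ ^ (-(3 / 4) : ℝ) := by
    calc D₂⁻¹ = D₂ ^ (-(1 : ℝ)) := by rw [Real.rpow_neg hDpos.le, Real.rpow_one]
      _ ≤ D₂ ^ (-(3 / 4) : ℝ) := Real.rpow_le_rpow_of_exponent_le hD1 (by norm_num)
      _ ≤ m₀ ^ (-(3 / 4) : ℝ) := Real.rpow_le_rpow_of_nonpos hm₀pos hD (by norm_num)
  have hD34 : D₂ ^ (-(3 / 4) : ℝ) ≤ m₀ ^ (-(3 / 4) : ℝ) :=
    Real.rpow_le_rpow_of_nonpos hm₀pos hD (by norm_num)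
  have h6 : (6 : ℝ) ^ (7 / 4 : ℝ) ≤ 36 := by
    calc (6 : ℝ) ^ (7 / 4 : ℝ) ≤ (6 : ℝ) ^ (2 : ℝ) :=
          Real.rpow_le_rpow_of_exponent_le (by norm_num) (by norm_num)
      _ = 36 := by norm_num
  have hm34 : 0 ≤ m₀ ^ (-(3 / 4) : ℝ) := by positivity
  rw [mul_add, h1, h2]
  have hA : 576 / g * D₂⁻¹ ≤ 576 / g * m₀ ^ (-(3 / 4) : ℝ) :=
    mul_le_mul_of_nonneg_left hinvD (by positivity)
  have hB : 16 * (6 : ℝ) ^ (7 / 4 : ℝ) / g * D₂ ^ (-(3 / 4) : ℝ) ≤ 16 * 36 / g * m₀ ^ (-(3 / 4) : ℝ) := by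
    have h3 : 16 * (6 : ℝ) ^ (7 / 4 : ℝ) / g ≤ 16 * 36 / g := by
      apply div_le_div_of_nonneg_right _ hg.le
      linarith
    have h4 : 0 ≤ 16 * (6 : ℝ) ^ (7 / 4 : ℝ) / g := by positivity
    calc 16 * (6 : ℝ) ^ (7 / 4 : ℝ) / g * D₂ ^ (-(3 / 4) : ℝ)
        ≤ 16 * (6 : ℝ) ^ (7 / 4 : ℝ) / g * m₀ ^ (-(3 / 4) : ℝ) := mul_le_mul_of_nonneg_left hD34 h4
      _ ≤ 16 * 36 / g * m₀ ^ (-(3 / 4) : ℝ) := mul_le_mul_of_nonneg_right h3 hm34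
  have : 576 / g * m₀ ^ (-(3 / 4) : ℝ) + 16 * 36 / g * m₀ ^ (-(3 / 4) : ℝ) = 1152 / g * m₀ ^ (-(3 / 4) : ℝ) := by
    ring
  linarith

end EscapeBudgets

end Summit.FinalStateConjecture.FinalStateConjecture.Theorems.ChargeKinematics

namespace Summit.FinalStateConjecture.FinalStateConjecture.Theorems

/-- REGISTERED STUB `two_partner_budget_le` of the crux item stmt-FinalStateConjecture-10166 (second line lead, line
`old-light-leaves-the-cone`, S4 escape series): the registered one-line signature verbatim, discharged by
`ChargeKinematics.two_partner_budget_le`. [folklore] -/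
theorem two_partner_budget_le : open Literature.Geometry.Lorentzian Filter Topology MeasureTheory intervalIntegral in ∀ {R d₁ d₂ φ₁ φ₁' φ₂ φ₂' : ℝ → ℝ} {t₀ τ m₀ c₂ g₁ g₂ : ℝ} (ht₀ : 0 < t₀) (hτ : t₀ ≤ τ) (hm₀ : 0 < m₀) (hc₂ : 0 < c₂) (hg₁ : 0 < g₁) (hg₂ : 0 < g₂) (hRcont : ContinuousOn R (Set.Icc t₀ τ)) (hd₁ : Continuous d₁) (hd₂ : Continuous d₂) (hR1 : ∀ s ∈ Set.Icc t₀ τ, 1 ≤ R s) (hRge : ∀ s ∈ Set.Icc t₀ τ, min (min (d₁ s) (d₂ s) / 3) (c₂ * s) ≤ R s) (hfl₁ : ∀ s ∈ Set.Icc t₀ τ, max m₀ |φ₁ s| ≤ d₁ s) (hfl₂ : ∀ s ∈ Set.Icc t₀ τ, max m₀ |φ₂ s| ≤ d₂ s) (hφ₁ : ∀ s, HasDerivAt φ₁ (φ₁' s) s) (hφ₁' : Continuous φ₁') (hmono₁ : ∀ s ∈ Set.Icc t₀ τ, g₁ ≤ φ₁' s) (hφ₂ : ∀ s, HasDerivAt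 φ₂ (φ₂' s) s) (hφ₂' : Continuous φ₂') (hmono₂ : ∀ s ∈ Set.Icc t₀ τ, g₂ ≤ φ₂' s), ∫ s in t₀..τ, (((R s) ^ 2)⁻¹ + ((R s) ^ (7 / 4 : ℝ))⁻¹) ≤ (9 * (2 * 2 * m₀ ^ (1 - 2 : ℝ) / ((2 - 1) * g₁)) + (3 : ℝ) ^ (7 / 4 : ℝ) * (2 * (7 / 4) * m₀ ^ (1 - 7 / 4 : ℝ) / ((7 / 4 - 1) * g₁)) + ((c₂ ^ 2 * t₀)⁻¹ + 4 / 3 * c₂ ^ (-(7 / 4) : ℝ) * t₀ ^ (-(3 / 4) : ℝ))) + (9 * (2 * 2 * m₀ ^ (1 - 2 : ℝ) / ((2 - 1) * g₂)) + (3 : ℝ) ^ (7 / 4 : ℝ) * (2 * (7 / 4) * m₀ ^ (1 - 7 / 4 : ℝ) / ((7 / 4 - 1) * g₂)) + ((c₂ ^ 2 * t₀)⁻¹ + 4 / 3 * c₂ ^ (-(7 / 4) : ℝ) * t₀ ^ (-(3 / 4) : ℝ))) :=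
  @ChargeKinematics.two_partner_budget_le

end Summit.FinalStateConjecture.FinalStateConjecture.Theorems

end
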